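/-
Copyright (c) 2026 the pub-hodgecm-mathlib formalisation cell (harness21).  Prover seat hodgecm-mathlib-LH4-p04 (g4), req620 Track A «(D-RAM) FOUR-FRAME» squad
(unit U2H_HSide, the (ρ2b′-X) payer road; payer LH4-p14 (g4) hand (C4) «T5s-RamK ∕ RamM» 05:05:59Z, dealer LH4-plan (g12) WORD #27; letters of record = LH4-p06 (g4) T5c
★ p857497∕p857535∕p857549 + ★ p857465 + this seat's validated class model (FILE 1); heir LEAD F0P3a-plan (g20) T19-05 (1) «class-keyed level letter» — RM: `2n_H = jl − dΘ∕2`).  2026-09-04.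
-/
import Summits.HodgeConjecture.HodgeConjecture.Theorems.F0P3cDyRamToricCensusSumRamMParts   -- FILE 1 (this seat): `tables_diff_ramM`, `col_zero_ramM`, `col_pos_ramM`; brings ★ p857624's blocks and ★ p857321's tools
import HarnessLib

/-!
# Crux `H413`, line LH4 «(D-RAM) FOUR-FRAME» road — unit U2H (ii-H), the (ρ2b′-X) payer: O-Sum ∕ T5s «TORIC CENSUS SUM», TYPE RamM — FILE 2∕2 «THE IDENTITY»:
# `ε·Σ_{j ≤ jl} Σ_a q^a (dep₊(j,a) − dep₋(j,a)) = q^m·(2[n_H + 1]_q − 2[S]_q)`, `2n_H = jl − g`, `g = dΘ∕2`, `S = d_E − d_E%2`, `d_E = g + s0`, `s0 = dτ∕2`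

Cell `hodgecm-mathlib` (D-0151), FLOOR 0, crux item H413 = `stmt-HodgeConjecture-24833`, route of record `HCCMUnconditional`; squad F0∕P3c∕LH4 (req618∕req620); registered stub
served: `F0P3cDyRamFourFrameU2H.stub_U2H_fixedPointCensus_typeTwo_unit0` ((ρ2b′-X), tree `Cruxes/H413/Lines/F0_P3c_DyRamFourFrame_U2H_HSide.lean` :418), organ O-Sum ∕ T5s
(payer lineage LH4-p14, HEAD-OF-ORGANS MAP v1 seam S7 «RK∕RM twins»; S7 consumes it as `(q−1)·Σ = ε·q^m·(2q^{n_H+1} − 2q^S)` with `Y_RM = 2[n_H+1]_q`), type RamM.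
THEOREMS ONLY (no `def`, no instance, no notation, no `sorry`, default heartbeats); lane `--supports stmt-HodgeConjecture-24833 --as helper` (count-neutral).

THE STATEMENT (HEAD BYTES v1 posted first, `F0/P3c/LH4/LH4-p04/g4/t5s/ramM/ToricCensusSumRamM.HEAD.v1.lean.LH4p04g4.txt` 10f75925bd8e2302; twin `head_twin_ramM.v1.LH4p04g4.py`
99b80361869197a4: 4320∕4320 tuples; letters ≡ the class engine `ramM_model.v1.LH4p04g4.py` 35fe9975f286b7b2 on 327 600 cells, which reproduces F0P3a-p01 (g32)'s E1 RamM rows: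
u-free 5524∕5524, (D1) 2734, (D2) 2066, dead-by-bit 266, both-alive 140, one-sided = ε-side 284∕284 on the non-FLIP rows).  WHY THE SAME SHAPE AS RamK: by the conductor–
discriminant formula `Δ_M = d_E + d_K + d′` the three relative conductors are `d_ρ = Δ_M − 2d_E`, `dΘ = Δ_M − 2d′ = 2g`, `dτ = Δ_M − 2d_K = 2s0`, whence `d_E = g + s0`, the RK-like
difference table in the shifted level `k = (j − a) − s0` with threshold `g`, the bit `2j + d_E ≤ 2jl + 1` (Φ-mechanism: `M∕K` ramified of lower break `2s0 − 1` gives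
`D = 4n_H + 1 + d_ρ − (2s0 − 1)`), and the far threshold `k′ ≥ 2g − 1`; the `ε = −1` window is `jl + 2 ≤ m + 2g + s0` (the non-norm class is live only for `ℓ ≤ 2g + s0 − 2`).
PROOF = FILE 1 + ★ p857624's blocks: columns first; `a = 0` gives `2x^{d_E}[⌊(jl−s0)∕2⌋ + 1 − g]`, a column `a ≥ 1` gives `[2a ≤ m ∧ 2g + 2a + s0 ≤ jl + 2]·(2x^{⌊(jl+s0)∕2⌋+a} −
2(x+1)x^{2a+d_E−2}) + ε·[window]·2x^{⌊(jl+s0)∕2⌋+a}`; two window re-indexings, one multiplication by `x − 1`, `ring` in the atoms `x^{⌈m∕2⌉−⌊d_E∕2⌋}, x^{⌊d_E∕2⌋−1},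
x^{⌊(jl−s0)∕2⌋−⌊m∕2⌋−g}, x` per parity of `d_E` (`ε = +1`), resp. `A = 0`, `B = RHS` (`ε = −1` window, `ε² = 1`) — the RamK skeleton of ★ p857635 token for token.
HONEST LABEL.  Count-neutral (`--supports`); nothing printed is asserted; (ρ2b′-X) `stub_U2H_fixedPointCensus_typeTwo_unit0` (U2H :418) stays a PROVER TARGET (an empirical
census law, kit-confirmed; (R-25): organ road measured at `tE = 2`) until its payer lands; the RamM letters for the no-translator classes still want their ★ organ (named in FILE 1);
`HC_CM` is proved only modulo the 7 printed citations (2 remaining named inputs: hLiu418 = `stmt-HodgeConjecture-24832`, h413 = `stmt-HodgeConjecture-24833`) until rung 0 closes.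

## References
* [Kottwitz1986BaseChangeUnits] R. E. Kottwitz, *Base change for unit elements of Hecke algebras*, Compositio Math. 60 (1986), §1 pp. 240–241 (orbital integrals of units as
  lattice counts modulo the torus).
* [Rogawski1990] J. D. Rogawski, *Automorphic Representations of Unitary Groups in Three Variables*, Ann. of Math. Stud. 123 (1990), §4.9 Prop. 4.9.1 (b) p. 55, Lemma 4.9.3 p. 56
  (the fixed-point census of a type-(2) element; the toric decomposition).
* [Flicker1998UnitaryFL] Y. Z. Flicker, *Elementary proof of the fundamental lemma for a unitary group*, Canad. J. Math. 50 (1998): Prop. 7 p. 84 (the level tables).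
* [Serre1979] J.-P. Serre, *Local Fields*, GTM 67 (1979): Ch. V §3 Cor. 3 (the norm on the unit filtration; the Hasse–Herbrand break).
-/

set_option autoImplicit false

namespace Summit.HodgeConjecture.HodgeConjecture.Cruxes.H413.F0P3cDyRamToricCensusSumRamM

open Finset
open Summit.HodgeConjecture.HodgeConjecture.Cruxes.H413.F0P3cDyRamToricCensusSumUnrBlocks (sum_range_window_reindex geom_sum_mul')
open Summit.HodgeConjecture.HodgeConjecture.Cruxes.H413.F0P3cDyRamToricCensusSumRamKParts (genBlock_mul topBlock_mul)
open Summit.HodgeConjecture.HodgeConjecture.Cruxes.H413.F0P3cDyRamToricCensusSumRamMParts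

set_option maxHeartbeats 400000 in
/-- **O-SUM ∕ T5s, TYPE RamM («E, K, K♮ ALL RAMIFIED») — THE TORIC CENSUS SUM.**  Parameters `g = dΘ∕2`, `s0 = dτ∕2` (so `d_E = g + s0`); let `nP nM : ℕ → ℕ → ℚ` be
the u-FREE LEVEL TABLES of the RamM class model (K♮-level `k = (j − a) − s0`: the odd-coset cell `k = −1` worth `q^j` on both sides; the even levels carry the translator class
on `+` (★ p857549∕p857465: `(q−1)q^{j−1−k∕2} ∣ (q−2)q^{j−1−k∕2} ∣ 2(q−1)q^{j−1−k∕2}` on `k + 2 <,=,> 2g`, cumulative row `(1∣2)q^{j−k∕2}`) and the non-norm class on `−`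
(`(q−1)q^{j−1−k∕2} ∣ q^{j−k∕2} ∣ 0`, cumulative row `q^{j−k∕2}·[k ≤ 2g−2]`); shallow levels whole) and let `vP vM` follow the DEPTH RULES at the tokens `(m, ε)` (GENERIC cells
`a ≤ m ∧ (j + a ≤ m ∨ (2a ≤ m ∧ j + a ≤ jl))` whole, off-diagonal non-generic cells empty, the diagonal `j + m = jl + a` top cells worth `q^j∕I(k′)`, `k′ = j + a − m − s0`,
alive iff `2j + d_E ≤ 2jl + 1` and — beyond `k′ ≥ 2g − 1` — only on the side `ε`).  Then for `q ≥ 2`, `g, s0 ≥ 1`, `jl ≡ g (2)` (H-LEVEL BINDER `2n_H = jl − g`),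
`S := d_E − d_E%2 ≤ n_H + 1`, on the token set `m ≡ d_E (2)`, `S − 1 ≤ m ≤ jl`, `ε = +1` or (`ε = −1` and `jl + 2 ≤ m + 2g + s0`):
`ε·Σ_{j ≤ jl} Σ_a q^a (vP j a − vM j a) = q^m·(2[n_H + 1]_q − 2[S]_q)` — the O-Sum organ of the (ρ2b′-X) payer, type RM.  Letters validated against F0P3a-p01 (g32)'s E1
rows (u-free 5524∕5524, depth 5206∕5206, one-sided cells 284∕284 off the FLIP rows); statement validated by a Lean-semantics twin (4320 tuples, q ≤ 8, g,s0 ≤ 4, jl ≤ 20).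
[cite: Kottwitz1986BaseChangeUnits, §1 pp. 240–241] [cite: Rogawski1990, §4.9 Prop. 4.9.1 (b) p. 55, Lemma 4.9.3 p. 56] [cite: Flicker1998UnitaryFL, Prop. 7 p. 84] [cite: Serre1979, Ch. V §3 Cor. 3] -/
theorem toricCensusSum_ramM (q : ℕ) {g s0 jl m : ℕ} (ε : ℚ) (hq : 2 ≤ q) (hg : 1 ≤ g) (hs0 : 1 ≤ s0) (hjl : jl % 2 = g % 2)
    (hjlS : 3 * g + 2 * s0 ≤ jl + 2 + 2 * ((g + s0) % 2)) (hpar : m % 2 = (g + s0) % 2) (hmS : g + s0 - (g + s0) % 2 ≤ m + 1) (hm : m ≤ jl)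
    (hε : ε = 1 ∨ (ε = -1 ∧ jl + 2 ≤ m + 2 * g + s0))
    (nP nM vP vM : ℕ → ℕ → ℚ)
    (hnP : ∀ j a, nP j a = ((if j = 0 then (if a = 0 then 1 else 0) else if j < a then 0
      else if j - a + 1 = s0 then q ^ j else if j - a + 1 < s0 then (if a = 0 then q ^ j else 0) else if (j - a - s0) % 2 = 1 then 0
      else if a = 0 then (if 2 * g ≤ j - a - s0 then 2 else 1) * q ^ (j - (j - a - s0) / 2)
      else if j - a - s0 + 2 < 2 * g then (q - 1) * q ^ (j - 1 - (j - a - s0) / 2) else if j - a - s0 + 2 = 2 * g then (q - 2) * q ^ (j - 1 - (j - a - s0) / 2)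
      else 2 * (q - 1) * q ^ (j - 1 - (j - a - s0) / 2) : ℕ) : ℚ))
    (hnM : ∀ j a, nM j a = ((if j = 0 then (if a = 0 then 1 else 0) else if j < a then 0
      else if j - a + 1 = s0 then q ^ j else if j - a + 1 < s0 then (if a = 0 then q ^ j else 0) else if (j - a - s0) % 2 = 1 then 0
      else if a = 0 then (if j - a - s0 + 2 ≤ 2 * g then q ^ (j - (j - a - s0) / 2) else 0)
      else if j - a - s0 + 2 < 2 * g then (q - 1) * q ^ (j - 1 - (j - a - s0) / 2) else if j - a - s0 + 2 = 2 * g then q ^ (j - (j - a - s0) / 2) else 0 : ℕ) : ℚ))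
    (hvGen : ∀ j a, (a ≤ m ∧ (j + a ≤ m ∨ (2 * a ≤ m ∧ j + a ≤ jl))) → vP j a = nP j a ∧ vM j a = nM j a)
    (hvOff : ∀ j a, ¬ (a ≤ m ∧ (j + a ≤ m ∨ (2 * a ≤ m ∧ j + a ≤ jl))) → j + m ≠ jl + a → vP j a = 0 ∧ vM j a = 0)
    (hvTop : ∀ j a, ¬ (a ≤ m ∧ (j + a ≤ m ∨ (2 * a ≤ m ∧ j + a ≤ jl))) → j + m = jl + a →
      (vP j a = if 2 * j + (g + s0) ≤ 2 * jl + 1 ∧ (j + a + 2 ≤ m + s0 + 2 * g ∨ ε = 1) then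
          (if j + a < m + s0 then (q : ℚ) ^ j else (if 2 * g ≤ j + a - m - s0 + 1 then 2 else 1) * (q : ℚ) ^ (j - (j + a - m - s0 + 1) / 2)) else 0) ∧
      (vM j a = if 2 * j + (g + s0) ≤ 2 * jl + 1 ∧ (j + a + 2 ≤ m + s0 + 2 * g ∨ ε = -1) then
          (if j + a < m + s0 then (q : ℚ) ^ j else (if 2 * g ≤ j + a - m - s0 + 1 then 2 else 1) * (q : ℚ) ^ (j - (j + a - m - s0 + 1) / 2)) else 0)) :
    ε * ∑ j ∈ range (jl + 1), ∑ a ∈ range (jl + 2), (q : ℚ) ^ a * (vP j a - vM j a) =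
      (q : ℚ) ^ m * (2 * ∑ i ∈ range ((jl - g) / 2 + 1), (q : ℚ) ^ i - 2 * ∑ i ∈ range (g + s0 - (g + s0) % 2), (q : ℚ) ^ i) := by
  set x : ℚ := (q : ℚ) with hxq
  have hx1 : x ≠ 1 := by rw [hxq]; exact_mod_cast (show q ≠ 1 by omega)
  have hε' : ε = 1 ∨ ε = -1 := hε.imp_right And.left
  have hεε : ε * ε = 1 := by rcases hε' with rfl | rfl <;> norm_num
  have hδ : ∀ j a, nP j a - nM j a = if a + s0 ≤ j ∧ (j - (a + s0)) % 2 = 0 then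
      (if a = 0 then (if 2 * g ≤ j - s0 then 2 * x ^ (j - (j - s0) / 2) else 0)
       else (if j - a - s0 + 2 = 2 * g then -2 * x ^ (j - 1 - (j - a - s0) / 2)
         else if 2 * g < j - a - s0 + 2 then 2 * (x - 1) * x ^ (j - 1 - (j - a - s0) / 2) else 0)) else 0 := fun j a => by rw [hnP, hnM]; exact tables_diff_ramM q hq hg j a
  -- columns first
  rw [Finset.sum_comm, Finset.sum_range_succ', col_zero_ramM x hg nP nM vP vM hδ hvGen,
    Finset.sum_congr rfl (fun a _ => col_pos_ramM x ε hε' hg hm nP nM vP vM hδ hvGen hvOff hvTop (show 1 ≤ a + 1 by omega)),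
    Finset.sum_add_distrib, ← Finset.mul_sum]
  -- the RHS, multiplied by `x − 1`
  have hR : (x - 1) * (x ^ m * (2 * ∑ i ∈ range ((jl - g) / 2 + 1), x ^ i - 2 * ∑ i ∈ range (g + s0 - (g + s0) % 2), x ^ i)) =
      2 * x ^ m * (x ^ ((jl - g) / 2 + 1) - x ^ (g + s0 - (g + s0) % 2)) := by
    have h1 := geom_sum_mul' x ((jl - g) / 2 + 1)
    have h2 := geom_sum_mul' x (g + s0 - (g + s0) % 2)
    linear_combination (2 * x ^ m) * h1 - (2 * x ^ m) * h2
  -- the column `a = 0`, multiplied by `x − 1`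
  have hC0 : (x - 1) * (2 * x ^ (g + s0) * ∑ k ∈ range ((jl - s0) / 2 + 1 - g), x ^ k) = 2 * x ^ (g + s0) * (x ^ ((jl - s0) / 2 + 1 - g) - 1) := by
    have h1 := geom_sum_mul' x ((jl - s0) / 2 + 1 - g)
    linear_combination (2 * x ^ (g + s0)) * h1
  by_cases hreg : jl + 2 ≤ m + 2 * g + s0
  · ---------------------------------------------------------------- the window `ℓ ≤ 2d − 2`: the generic part cancels, the top cells give everything
    -- generic columns: `a + 1 ≤ ⌊jl∕2⌋ + 1 − d`
    have hG : ∀ a ∈ range (jl + 1), (if 2 * (a + 1) ≤ m ∧ 2 * g + 2 * (a + 1) + s0 ≤ jl + 2 then 2 * x ^ ((jl + s0) / 2 + (a + 1)) - 2 * (x + 1) * x ^ (2 * (a + 1) + (g + s0) - 2) else 0) =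
        (if 0 ≤ a ∧ a < 0 + ((jl - s0) / 2 + 1 - g) then 2 * x ^ ((jl + s0) / 2 + 1) * x ^ a - 2 * (x + 1) * x ^ (g + s0) * x ^ (2 * a) else 0) := by
      intro a _
      by_cases h : 2 * (a + 1) ≤ m ∧ 2 * g + 2 * (a + 1) + s0 ≤ jl + 2
      · rw [if_pos h, if_pos (by omega), show (jl + s0) / 2 + (a + 1) = ((jl + s0) / 2 + 1) + a by omega, pow_add, show 2 * (a + 1) + (g + s0) - 2 = (g + s0) + 2 * a by omega, pow_add]; ring
      · rw [if_neg h, if_neg (by omega)]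
    -- top cells: `m + S − ⌊jl∕2⌋ ≤ a + 1 ≤ m − ⌊d∕2⌋`
    have hT : ∀ a ∈ range (jl + 1), (if m < 2 * (a + 1) ∧ 2 * (a + 1) + (g + s0) ≤ 2 * m + 1 ∧ 2 * m + 2 * g + s0 ≤ jl + 2 * (a + 1) + 1 then 2 * x ^ ((jl + s0) / 2 + (a + 1)) else 0) =
        (if (m + (g + s0 - (g + s0) % 2) - (jl + s0) / 2 - 1) ≤ a ∧ a < (m + (g + s0 - (g + s0) % 2) - (jl + s0) / 2 - 1) + ((jl - g) / 2 + 1 - (g + s0 - (g + s0) % 2)) then 2 * x ^ (m + (g + s0 - (g + s0) % 2)) * x ^ (a - (m + (g + s0 - (g + s0) % 2) - (jl + s0) / 2 - 1)) else 0) := by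
      intro a _
      by_cases h : m < 2 * (a + 1) ∧ 2 * (a + 1) + (g + s0) ≤ 2 * m + 1 ∧ 2 * m + 2 * g + s0 ≤ jl + 2 * (a + 1) + 1
      · rw [if_pos h, if_pos (by omega), show (jl + s0) / 2 + (a + 1) = (m + (g + s0 - (g + s0) % 2)) + (a - (m + (g + s0 - (g + s0) % 2) - (jl + s0) / 2 - 1)) by omega, pow_add, ← mul_assoc]
      · rw [if_neg h, if_neg (by omega)]
    rw [Finset.sum_congr rfl hG, sum_range_window_reindex (fun a => 2 * x ^ ((jl + s0) / 2 + 1) * x ^ a - 2 * (x + 1) * x ^ (g + s0) * x ^ (2 * a)) (show 0 + ((jl - s0) / 2 + 1 - g) ≤ jl + 1 by omega),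
      Finset.sum_congr rfl hT, sum_range_window_reindex (fun a => 2 * x ^ (m + (g + s0 - (g + s0) % 2)) * x ^ (a - (m + (g + s0 - (g + s0) % 2) - (jl + s0) / 2 - 1)))
        (show (m + (g + s0 - (g + s0) % 2) - (jl + s0) / 2 - 1) + ((jl - g) / 2 + 1 - (g + s0 - (g + s0) % 2)) ≤ jl + 1 by omega)]
    simp_rw [zero_add, Nat.add_sub_cancel_left]
    have hA : (x - 1) * (∑ i ∈ range ((jl - s0) / 2 + 1 - g), (2 * x ^ ((jl + s0) / 2 + 1) * x ^ i - 2 * (x + 1) * x ^ (g + s0) * x ^ (2 * i)) + 2 * x ^ (g + s0) * ∑ k ∈ range ((jl - s0) / 2 + 1 - g), x ^ k) = 0 := by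
      rw [mul_add, genBlock_mul, hC0]
      have f1 : x ^ ((jl + s0) / 2 + 1) = x ^ ((jl - s0) / 2 + 1 - g) * x ^ (g + s0) := by rw [← pow_add]; congr 1; omega
      have f2 : x ^ (2 * ((jl - s0) / 2 + 1 - g)) = x ^ ((jl - s0) / 2 + 1 - g) * x ^ ((jl - s0) / 2 + 1 - g) := by rw [← pow_add]; congr 1; omega
      rw [f1, f2]; ring
    have hA' : ∑ i ∈ range ((jl - s0) / 2 + 1 - g), (2 * x ^ ((jl + s0) / 2 + 1) * x ^ i - 2 * (x + 1) * x ^ (g + s0) * x ^ (2 * i)) + 2 * x ^ (g + s0) * ∑ k ∈ range ((jl - s0) / 2 + 1 - g), x ^ k = 0 := by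
      rcases mul_eq_zero.1 hA with h | h
      · exact absurd (sub_eq_zero.1 h) hx1
      · exact h
    have hB : (x - 1) * ∑ i ∈ range ((jl - g) / 2 + 1 - (g + s0 - (g + s0) % 2)), 2 * x ^ (m + (g + s0 - (g + s0) % 2)) * x ^ i =
        (x - 1) * (x ^ m * (2 * ∑ i ∈ range ((jl - g) / 2 + 1), x ^ i - 2 * ∑ i ∈ range (g + s0 - (g + s0) % 2), x ^ i)) := by
      rw [topBlock_mul, hR]
      have f1 : x ^ ((jl - g) / 2 + 1) = x ^ (g + s0 - (g + s0) % 2) * x ^ ((jl - g) / 2 + 1 - (g + s0 - (g + s0) % 2)) := by rw [← pow_add]; congr 1; omega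
      rw [pow_add, f1]; ring
    have hB' := mul_left_cancel₀ (sub_ne_zero.2 hx1) hB
    rw [show ε * (∑ i ∈ range ((jl - s0) / 2 + 1 - g), (2 * x ^ ((jl + s0) / 2 + 1) * x ^ i - 2 * (x + 1) * x ^ (g + s0) * x ^ (2 * i)) +
          ε * ∑ i ∈ range ((jl - g) / 2 + 1 - (g + s0 - (g + s0) % 2)), 2 * x ^ (m + (g + s0 - (g + s0) % 2)) * x ^ i + 2 * x ^ (g + s0) * ∑ k ∈ range ((jl - s0) / 2 + 1 - g), x ^ k) =
        ε * (∑ i ∈ range ((jl - s0) / 2 + 1 - g), (2 * x ^ ((jl + s0) / 2 + 1) * x ^ i - 2 * (x + 1) * x ^ (g + s0) * x ^ (2 * i)) + 2 * x ^ (g + s0) * ∑ k ∈ range ((jl - s0) / 2 + 1 - g), x ^ k) +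
        ε * ε * ∑ i ∈ range ((jl - g) / 2 + 1 - (g + s0 - (g + s0) % 2)), 2 * x ^ (m + (g + s0 - (g + s0) % 2)) * x ^ i by ring,
      hA', hεε, mul_zero, zero_add, one_mul, hB']
  · ---------------------------------------------------------------- `ℓ ≥ 2d`: `ε = +1`, generic columns `a + 1 ≤ ⌊m∕2⌋`, top cells `⌊m∕2⌋ + 1 ≤ a + 1 ≤ m − ⌊d∕2⌋`
    have hε1 : ε = 1 := by rcases hε with h | ⟨_, h⟩; exact h; exact absurd h hreg
    subst hε1
    have hG : ∀ a ∈ range (jl + 1), (if 2 * (a + 1) ≤ m ∧ 2 * g + 2 * (a + 1) + s0 ≤ jl + 2 then 2 * x ^ ((jl + s0) / 2 + (a + 1)) - 2 * (x + 1) * x ^ (2 * (a + 1) + (g + s0) - 2) else 0) =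
        (if 0 ≤ a ∧ a < 0 + m / 2 then 2 * x ^ ((jl + s0) / 2 + 1) * x ^ a - 2 * (x + 1) * x ^ (g + s0) * x ^ (2 * a) else 0) := by
      intro a _
      by_cases h : 2 * (a + 1) ≤ m ∧ 2 * g + 2 * (a + 1) + s0 ≤ jl + 2
      · rw [if_pos h, if_pos (by omega), show (jl + s0) / 2 + (a + 1) = ((jl + s0) / 2 + 1) + a by omega, pow_add, show 2 * (a + 1) + (g + s0) - 2 = (g + s0) + 2 * a by omega, pow_add]; ring
      · rw [if_neg h, if_neg (by omega)]
    have hT : ∀ a ∈ range (jl + 1), (if m < 2 * (a + 1) ∧ 2 * (a + 1) + (g + s0) ≤ 2 * m + 1 ∧ 2 * m + 2 * g + s0 ≤ jl + 2 * (a + 1) + 1 then 2 * x ^ ((jl + s0) / 2 + (a + 1)) else 0) =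
        (if m / 2 ≤ a ∧ a < m / 2 + (m - (g + s0) / 2 - m / 2) then 2 * x ^ ((jl + s0) / 2 + m / 2 + 1) * x ^ (a - m / 2) else 0) := by
      intro a _
      by_cases h : m < 2 * (a + 1) ∧ 2 * (a + 1) + (g + s0) ≤ 2 * m + 1 ∧ 2 * m + 2 * g + s0 ≤ jl + 2 * (a + 1) + 1
      · rw [if_pos h, if_pos (by omega), show (jl + s0) / 2 + (a + 1) = ((jl + s0) / 2 + m / 2 + 1) + (a - m / 2) by omega, pow_add, ← mul_assoc]
      · rw [if_neg h, if_neg (by omega)]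
    rw [Finset.sum_congr rfl hG, sum_range_window_reindex (fun a => 2 * x ^ ((jl + s0) / 2 + 1) * x ^ a - 2 * (x + 1) * x ^ (g + s0) * x ^ (2 * a)) (show 0 + m / 2 ≤ jl + 1 by omega),
      Finset.sum_congr rfl hT, sum_range_window_reindex (fun a => 2 * x ^ ((jl + s0) / 2 + m / 2 + 1) * x ^ (a - m / 2)) (show m / 2 + (m - (g + s0) / 2 - m / 2) ≤ jl + 1 by omega)]
    simp_rw [zero_add, Nat.add_sub_cancel_left, one_mul]
    apply mul_left_cancel₀ (sub_ne_zero.2 hx1)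
    rw [mul_add, mul_add, genBlock_mul, topBlock_mul, hC0, hR]
    -- atoms: `x^r` (`r = ⌈m∕2⌉ − ⌊d∕2⌋`), `x^t` (`t = ⌊d∕2⌋ − 1`), `x^u` (`u = ⌊jl∕2⌋ − ⌊m∕2⌋ − d`), `x`
    rcases Nat.mod_two_eq_zero_or_one (g + s0) with hδ | hδ
    · have f1 : x ^ ((jl + s0) / 2 + 1) = x ^ (m - (g + s0) / 2 - m / 2) * x ^ ((g + s0) / 2 - 1) * x ^ ((g + s0) / 2 - 1) * x ^ ((g + s0) / 2 - 1) * x ^ ((jl - s0) / 2 - m / 2 - g) * x * x * x * x := by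
        simp only [← pow_add, ← pow_succ]; congr 1; omega
      have f2 : x ^ (m / 2) = x ^ (m - (g + s0) / 2 - m / 2) * x ^ ((g + s0) / 2 - 1) * x := by simp only [← pow_add, ← pow_succ]; congr 1; omega
      have f3 : x ^ (g + s0) = x ^ ((g + s0) / 2 - 1) * x ^ ((g + s0) / 2 - 1) * x * x := by simp only [← pow_add, ← pow_succ]; congr 1; omega
      have f4 : x ^ (2 * (m / 2)) = x ^ (m - (g + s0) / 2 - m / 2) * x ^ (m - (g + s0) / 2 - m / 2) * x ^ ((g + s0) / 2 - 1) * x ^ ((g + s0) / 2 - 1) * x * x := by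
        simp only [← pow_add, ← pow_succ]; congr 1; omega
      have f5 : x ^ ((jl + s0) / 2 + m / 2 + 1) = x ^ (m - (g + s0) / 2 - m / 2) * x ^ (m - (g + s0) / 2 - m / 2) * x ^ ((g + s0) / 2 - 1) * x ^ ((g + s0) / 2 - 1) * x ^ ((g + s0) / 2 - 1) * x ^ ((g + s0) / 2 - 1) *
          x ^ ((jl - s0) / 2 - m / 2 - g) * x * x * x * x * x := by simp only [← pow_add, ← pow_succ]; congr 1; omega
      have f6 : x ^ ((jl - s0) / 2 + 1 - g) = x ^ (m - (g + s0) / 2 - m / 2) * x ^ ((g + s0) / 2 - 1) * x ^ ((jl - s0) / 2 - m / 2 - g) * x * x := by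
        simp only [← pow_add, ← pow_succ]; congr 1; omega
      have f7 : x ^ m = x ^ (m - (g + s0) / 2 - m / 2) * x ^ (m - (g + s0) / 2 - m / 2) * x ^ ((g + s0) / 2 - 1) * x ^ ((g + s0) / 2 - 1) * x * x := by
        simp only [← pow_add, ← pow_succ]; congr 1; omega
      have f8 : x ^ ((jl - g) / 2 + 1) = x ^ (m - (g + s0) / 2 - m / 2) * x ^ ((g + s0) / 2 - 1) * x ^ ((g + s0) / 2 - 1) * x ^ ((jl - s0) / 2 - m / 2 - g) * x * x * x := by
        simp only [← pow_add, ← pow_succ]; congr 1; omega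
      have f9 : x ^ (g + s0 - (g + s0) % 2) = x ^ ((g + s0) / 2 - 1) * x ^ ((g + s0) / 2 - 1) * x * x := by simp only [← pow_add, ← pow_succ]; congr 1; omega
      rw [f1, f2, f3, f4, f5, f6, f7, f8, f9]; ring
    · have f1 : x ^ ((jl + s0) / 2 + 1) = x ^ (m - (g + s0) / 2 - m / 2) * x ^ ((g + s0) / 2 - 1) * x ^ ((g + s0) / 2 - 1) * x ^ ((g + s0) / 2 - 1) * x ^ ((jl - s0) / 2 - m / 2 - g) * x * x * x * x := by
        simp only [← pow_add, ← pow_succ]; congr 1; omega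
      have f2 : x ^ (m / 2) = x ^ (m - (g + s0) / 2 - m / 2) * x ^ ((g + s0) / 2 - 1) := by simp only [← pow_add]; congr 1; omega
      have f3 : x ^ (g + s0) = x ^ ((g + s0) / 2 - 1) * x ^ ((g + s0) / 2 - 1) * x * x * x := by simp only [← pow_add, ← pow_succ]; congr 1; omega
      have f4 : x ^ (2 * (m / 2)) = x ^ (m - (g + s0) / 2 - m / 2) * x ^ (m - (g + s0) / 2 - m / 2) * x ^ ((g + s0) / 2 - 1) * x ^ ((g + s0) / 2 - 1) := by
        simp only [← pow_add]; congr 1; omega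
      have f5 : x ^ ((jl + s0) / 2 + m / 2 + 1) = x ^ (m - (g + s0) / 2 - m / 2) * x ^ (m - (g + s0) / 2 - m / 2) * x ^ ((g + s0) / 2 - 1) * x ^ ((g + s0) / 2 - 1) * x ^ ((g + s0) / 2 - 1) * x ^ ((g + s0) / 2 - 1) *
          x ^ ((jl - s0) / 2 - m / 2 - g) * x * x * x * x := by simp only [← pow_add, ← pow_succ]; congr 1; omega
      have f6 : x ^ ((jl - s0) / 2 + 1 - g) = x ^ (m - (g + s0) / 2 - m / 2) * x ^ ((g + s0) / 2 - 1) * x ^ ((jl - s0) / 2 - m / 2 - g) * x := by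
        simp only [← pow_add, ← pow_succ]; congr 1; omega
      have f7 : x ^ m = x ^ (m - (g + s0) / 2 - m / 2) * x ^ (m - (g + s0) / 2 - m / 2) * x ^ ((g + s0) / 2 - 1) * x ^ ((g + s0) / 2 - 1) * x := by
        simp only [← pow_add, ← pow_succ]; congr 1; omega
      have f8 : x ^ ((jl - g) / 2 + 1) = x ^ (m - (g + s0) / 2 - m / 2) * x ^ ((g + s0) / 2 - 1) * x ^ ((g + s0) / 2 - 1) * x ^ ((jl - s0) / 2 - m / 2 - g) * x * x * x := by
        simp only [← pow_add, ← pow_succ]; congr 1; omega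
      have f9 : x ^ (g + s0 - (g + s0) % 2) = x ^ ((g + s0) / 2 - 1) * x ^ ((g + s0) / 2 - 1) * x * x := by simp only [← pow_add, ← pow_succ]; congr 1; omega
      rw [f1, f2, f3, f4, f5, f6, f7, f8, f9]; ring

end Summit.HodgeConjecture.HodgeConjecture.Cruxes.H413.F0P3cDyRamToricCensusSumRamM
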